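import Mathlib
import HarnessLib
import Summits.Ventures.LatticeQCDFlow.Scaling.GeneralLayerESSFloorSharp

/-!
# GeneralLayerESSAsymptotics — the `n_step → ∞` limit of the general-layer ESS floor:
# `ÊSS_n → 1` and `n·(−log ÊSS_n) ≤ 2τ̄(ρ)·σ̄² + ε` eventually, `2τ̄(ρ) = (1+ρ)/(1−ρ)`, for EVERY
# sequence of layer families of fixed quality `(ρ, ΔD, σ̄)`

HONEST FRAMING: exact (Metropolis-corrected) sampling algorithms for lattice gauge theory;
figures of merit are autocorrelation/cost numbers at stated couplings and volumes; no
continuum-physics claim.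

Venture `LatticeQCDFlow` (cell pub-lqcd), topic `Scaling`; FANOUT row 19 (`su2-snf`, GEN-7).
OUR WORK (elementary real analysis over `Scaling/GeneralLayerESSFloorSharp`, this seat); nothing is
cited as a fact.

`Scaling/GeneralLayerESSFloorSharp.exp_le_ess_path_uniform_sharp` bounds the path-space ESS of the
`n`-step uniform switching protocol `S_{k/n} = S₀ + (k/n)·D` with ARBITRARY positive layers (unit
row sums, Boltzmann-invariant, `χ²`-contracting towards their targets with `ρ`) from below by
`exp(−((1+θ_n)/(1−θ_n))·σ̄²/n)`, `θ_n = ρ·e^{3ΔD/n}`, whenever `θ_n < 1` — a finite-`n` statement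
whose constant carries the sup-norm change-of-reference factor `e^{3ΔD/n}`.  This file removes the
factor in the limit: for every sequence `P⁽ⁿ⁾` of layer families (one family per step count `n`,
each of the stated quality with the SAME `ρ < 1`, `ΔD`, `σ̄`) and every `ε > 0`,

* **`eventually_exp_le_ess_path_uniform`** — `exp(−(2τ̄(ρ)σ̄² + ε)/n) ≤ ÊSS_n` for all large `n`;
* **`eventually_mul_neg_log_ess_path_uniform_le`** — `n·(−log ÊSS_n) ≤ 2τ̄(ρ)σ̄² + ε` for all
  large `n`: E7's `−log ESS = k′·n_dof/n_step`, `k′ = 2τ_int·σ²Δ²` (`Scaling/AR1SwitchingLaw`) as the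
  certified ASYMPTOTIC upper envelope of `−log ÊSS` for every relaxation scheme of contraction `ρ`
  (`2τ̄(ρ) = (1+ρ)/(1−ρ) = 2·tauInt ρ` of the AR(1) dictionary, `two_tauBar_eq`), with no
  `ΔD`-dependence left;
* **`tendsto_ess_path_uniform`** — `ÊSS_n → 1` (`n → ∞`): refining the protocol always drives the
  path ESS of such a non-equilibrium sampler to one (squeeze against `ÊSS ≤ 1`);
* the reversible instances `…_of_reversible` (`ρ = sup_{n,k} λ⋆(P⁽ⁿ⁾_k) < 1`, positive irreducible
  layers in detailed balance with their targets).

The analysis is factored through an arbitrary sequence `E n` obeying the floor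
(`eventually_exp_le_of_floor`, `eventually_mul_neg_log_le_of_floor`, `tendsto_one_of_floor`), so
any later floor of the same shape (other grids, other `θ_n → ρ`) inherits the three statements.
§1 is the calculus: `θ_n → ρ` (`tendsto_mul_exp_div`), the envelope constant
`(1+θ_n)/(1−θ_n)·b → (1+ρ)/(1−ρ)·b` (`tendsto_essEnvelope`), hence eventually `θ_n < 1` and the
constant is within `ε` of its limit (`eventually_essEnvelope_le`).

NOT CLAIMED: a rate in `ε` (the `O(ΔD/n)` correction is explicit in the finite-`n` floor, not
extracted here); anything about `ρ_n → 1` regimes (critical slowing down of the layers themselves: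
then `2τ̄(ρ_n) → ∞` and the envelope is void, honestly); any value of `ρ`, `σ̄`, `ΔD` for a lattice
kernel; the sample (Kish) ESS of a finite run.
-/

namespace Summit.Ventures.LatticeQCDFlow.Scaling

open Finset Filter Topology
open Literature.Probability.MarkovChains (IsRowStochastic IsStationary stepLaw DetailedBalance
  IsIrreducible lambdaStar lambdaStar_nonneg)
open Summit.Ventures.LatticeQCDFlow.Exactness
open Summit.Ventures.LatticeQCDFlow.Theory2

/-! ## §1 The envelope constant as `n → ∞` -/

/-- `θ_n = ρ·e^{a/n} → ρ` as `n → ∞`. -/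
theorem tendsto_mul_exp_div (ρ a : ℝ) :
    Tendsto (fun n : ℕ => ρ * Real.exp (a / n)) atTop (𝓝 ρ) := by
  have h1 : Tendsto (fun n : ℕ => a / (n : ℝ)) atTop (𝓝 0) :=
    tendsto_const_div_atTop_nhds_zero_nat a
  have := ((Real.continuous_exp.tendsto 0).comp h1).const_mul ρ
  simpa using this

/-- **The envelope constant tends to the AR(1) constant**:
`(1 + ρe^{a/n})/(1 − ρe^{a/n})·b → ((1+ρ)/(1−ρ))·b` for `ρ < 1`. -/
theorem tendsto_essEnvelope (ρ a b : ℝ) (hρ1 : ρ < 1) :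
    Tendsto (fun n : ℕ => (1 + ρ * Real.exp (a / n)) / (1 - ρ * Real.exp (a / n)) * b)
      atTop (𝓝 ((1 + ρ) / (1 - ρ) * b)) := by
  have h2 := tendsto_mul_exp_div ρ a
  exact ((h2.const_add 1).div (h2.const_sub 1) (by linarith)).mul_const b

/-- Eventually `θ_n < 1` and the envelope constant is within `ε` of its limit. -/
theorem eventually_essEnvelope_le (ρ a b : ℝ) {ε : ℝ} (hρ1 : ρ < 1) (hε : 0 < ε) :
    ∀ᶠ n : ℕ in atTop, ρ * Real.exp (a / n) < 1 ∧
      (1 + ρ * Real.exp (a / n)) / (1 - ρ * Real.exp (a / n)) * b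
        ≤ (1 + ρ) / (1 - ρ) * b + ε := by
  have hA : ∀ᶠ n : ℕ in atTop, ρ * Real.exp (a / n) < 1 :=
    (tendsto_mul_exp_div ρ a).eventually (gt_mem_nhds hρ1)
  have hB : ∀ᶠ n : ℕ in atTop,
      (1 + ρ * Real.exp (a / n)) / (1 - ρ * Real.exp (a / n)) * b
        < (1 + ρ) / (1 - ρ) * b + ε :=
    (tendsto_essEnvelope ρ a b hρ1).eventually (gt_mem_nhds (by linarith))
  filter_upwards [hA, hB] with n hn hn'
  exact ⟨hn, hn'.le⟩

/-- `exp(−c/n) → 1` as `n → ∞`. -/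
theorem tendsto_exp_neg_div (c : ℝ) :
    Tendsto (fun n : ℕ => Real.exp (-(c / n))) atTop (𝓝 1) := by
  have h1 : Tendsto (fun n : ℕ => -(c / (n : ℝ))) atTop (𝓝 0) := by
    simpa using (tendsto_const_div_atTop_nhds_zero_nat c).neg
  have h2 := (Real.continuous_exp.tendsto 0).comp h1
  rw [Real.exp_zero] at h2
  exact h2

/-! ## §2 Any sequence obeying a floor of this shape -/

/-- **From the finite-`n` floor to the asymptotic floor.**  If a sequence `E n` satisfies
`exp(−((1+θ_n)/(1−θ_n))·(b/n)) ≤ E n` whenever `n ≠ 0` and `θ_n = ρe^{a/n} < 1`, and `ρ < 1`, then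
for every `ε > 0`: `exp(−(((1+ρ)/(1−ρ))·b + ε)/n) ≤ E n` for all large `n`. -/
theorem eventually_exp_le_of_floor (E : ℕ → ℝ) {ρ a b ε : ℝ} (hρ1 : ρ < 1) (hε : 0 < ε)
    (hfloor : ∀ n : ℕ, n ≠ 0 → ρ * Real.exp (a / n) < 1 →
      Real.exp (-((1 + ρ * Real.exp (a / n)) / (1 - ρ * Real.exp (a / n)) * (b / n))) ≤ E n) :
    ∀ᶠ n : ℕ in atTop, Real.exp (-(((1 + ρ) / (1 - ρ) * b + ε) / n)) ≤ E n := by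
  filter_upwards [eventually_essEnvelope_le ρ a b hρ1 hε, eventually_ne_atTop 0] with n hn hn0
  refine le_trans ?_ (hfloor n hn0 hn.1)
  rw [Real.exp_le_exp, neg_le_neg_iff]
  have hnpos : (0 : ℝ) < n := Nat.cast_pos.mpr (Nat.pos_of_ne_zero hn0)
  rw [show (1 + ρ * Real.exp (a / n)) / (1 - ρ * Real.exp (a / n)) * (b / n)
      = ((1 + ρ * Real.exp (a / n)) / (1 - ρ * Real.exp (a / n)) * b) / n by ring]
  exact div_le_div_of_nonneg_right hn.2 hnpos.le

/-- **`n·(−log E n) ≤ ((1+ρ)/(1−ρ))·b + ε` for all large `n`** under the same floor. -/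
theorem eventually_mul_neg_log_le_of_floor (E : ℕ → ℝ) {ρ a b ε : ℝ} (hρ1 : ρ < 1) (hε : 0 < ε)
    (hfloor : ∀ n : ℕ, n ≠ 0 → ρ * Real.exp (a / n) < 1 →
      Real.exp (-((1 + ρ * Real.exp (a / n)) / (1 - ρ * Real.exp (a / n)) * (b / n))) ≤ E n) :
    ∀ᶠ n : ℕ in atTop, (n : ℝ) * -Real.log (E n) ≤ (1 + ρ) / (1 - ρ) * b + ε := by
  filter_upwards [eventually_exp_le_of_floor E hρ1 hε hfloor, eventually_ne_atTop 0] with n hn hn0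
  have hnpos : (0 : ℝ) < n := Nat.cast_pos.mpr (Nat.pos_of_ne_zero hn0)
  have hE : 0 < E n := (Real.exp_pos _).trans_le hn
  have hlog : -(((1 + ρ) / (1 - ρ) * b + ε) / n) ≤ Real.log (E n) := by
    rw [← Real.log_exp (-(((1 + ρ) / (1 - ρ) * b + ε) / n))]
    exact Real.log_le_log (Real.exp_pos _) hn
  have h := mul_le_mul_of_nonneg_left (neg_le_neg hlog) hnpos.le
  rw [neg_neg, mul_div_cancel₀ _ hnpos.ne'] at h
  exact h

/-- **`E n → 1`** under the same floor, if also `E n ≤ 1` for all large `n` (squeeze). -/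
theorem tendsto_one_of_floor (E : ℕ → ℝ) {ρ a b : ℝ} (hρ1 : ρ < 1)
    (hfloor : ∀ n : ℕ, n ≠ 0 → ρ * Real.exp (a / n) < 1 →
      Real.exp (-((1 + ρ * Real.exp (a / n)) / (1 - ρ * Real.exp (a / n)) * (b / n))) ≤ E n)
    (hle : ∀ᶠ n : ℕ in atTop, E n ≤ 1) :
    Tendsto E atTop (𝓝 1) := by
  refine tendsto_of_tendsto_of_tendsto_of_le_of_le' (tendsto_exp_neg_div ((1 + ρ) / (1 - ρ) * b + 1))
    tendsto_const_nhds (eventually_exp_le_of_floor E hρ1 one_pos hfloor) hle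

/-! ## §3 The path ESS of the uniform protocol with layer families of fixed quality -/

section Layers

variable {X : Type*} [Fintype X] [Nonempty X]

/-- `ÊSS ≤ 1` on path space for positive layers with unit row sums leaving the Boltzmann weights of
their targets invariant (both path laws are probability vectors). -/
theorem ess_path_uniform_le_one (S₀ D : X → ℝ) (Q : ℕ → X → X → ℝ) {n : ℕ}
    (hQpos : ∀ k x y, 0 < Q k x y)
    (hst : ∀ k, IsStationary
      (fun x => Real.exp (-(linAction S₀ D (((k + 1 : ℕ) : ℝ) / n) x))) (Q k))
    (hQrow : ∀ k x, ∑ y, Q k x y = 1) :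
    essFrac (revPathLaw (fun k : Fin (n + 1) => linAction S₀ D ((k : ℝ) / n))
          (fun k : Fin n => Q k))
        (pathLaw (gibbsLaw (linAction S₀ D (((0 : Fin (n + 1)) : ℝ) / n))) (fun k : Fin n => Q k))
      ≤ 1 := by
  have hst' : ∀ k : Fin n, IsStationary
      (fun x => Real.exp (-((fun k : Fin (n + 1) => linAction S₀ D ((k : ℝ) / n)) k.succ x)))
      ((fun k : Fin n => Q k) k) := by
    intro k; simpa only [Fin.val_succ] using hst k
  have hF1 : ∑ ω : Fin (n + 1) → X,
      pathLaw (gibbsLaw (linAction S₀ D (((0 : Fin (n + 1)) : ℝ) / n))) (fun k : Fin n => Q k) ω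
        = 1 := by
    rw [sum_pathLaw _ _ (fun k x => hQrow k x), sum_gibbsLaw]
  exact essFrac_le_one (fun ω => pathLaw_pos (gibbsLaw_pos _) (fun k x y => hQpos k x y) ω)
    (sum_revPathLaw _ _ hst') hF1

/-- **THE ASYMPTOTIC FLOOR.**  For every sequence `P n` of layer families (positive, unit row sums,
Boltzmann-invariant, `χ²`-contracting towards their targets along the `n`-step uniform grid with a
common `ρ < 1`), `|D x − D y| ≤ ΔD`, `Var_c(D) ≤ σ̄²`, and every `ε > 0`:
`exp(−(((1+ρ)/(1−ρ))σ̄² + ε)/n) ≤ ÊSS_n` for all large `n`. -/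
theorem eventually_exp_le_ess_path_uniform (S₀ D : X → ℝ) (P : ℕ → ℕ → X → X → ℝ)
    {ΔD ρ σbar ε : ℝ} (hD : ∀ x y, |D x - D y| ≤ ΔD) (hPpos : ∀ (n k : ℕ) (x y : X), 0 < P n k x y)
    (hst : ∀ (n k : ℕ), IsStationary
      (fun x => Real.exp (-(linAction S₀ D (((k + 1 : ℕ) : ℝ) / n) x))) (P n k))
    (hProw : ∀ (n k : ℕ) (x : X), ∑ y, P n k x y = 1)
    (hK : ∀ (n k : ℕ), ChiSqContracts (P n k) (gibbsLaw (linAction S₀ D (((k + 1 : ℕ) : ℝ) / n))) ρ)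
    (hρ0 : 0 ≤ ρ) (hρ1 : ρ < 1) (hσ0 : 0 ≤ σbar) (hσ : ∀ c, varD S₀ D c ≤ σbar ^ 2)
    (hε : 0 < ε) :
    ∀ᶠ n : ℕ in atTop, Real.exp (-(((1 + ρ) / (1 - ρ) * σbar ^ 2 + ε) / n))
      ≤ essFrac (revPathLaw (fun k : Fin (n + 1) => linAction S₀ D ((k : ℝ) / n))
            (fun k : Fin n => P n k))
          (pathLaw (gibbsLaw (linAction S₀ D (((0 : Fin (n + 1)) : ℝ) / n)))
            (fun k : Fin n => P n k)) :=
  eventually_exp_le_of_floor _ hρ1 hε fun n hn0 hθ =>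
    exp_le_ess_path_uniform_sharp S₀ D (P n) hn0 hD (hPpos n) (hst n) (hProw n) (hK n) hρ0 hσ0
      hσ hθ

/-- **THE ASYMPTOTIC `k′` LAW.**  Under the hypotheses of `eventually_exp_le_ess_path_uniform`:
`n·(−log ÊSS_n) ≤ ((1+ρ)/(1−ρ))·σ̄² + ε` for all large `n` — E7's `k′ = 2τ_int σ²Δ²` as the
certified asymptotic envelope, free of the change-of-reference factor `e^{3ΔD/n}`. -/
theorem eventually_mul_neg_log_ess_path_uniform_le (S₀ D : X → ℝ) (P : ℕ → ℕ → X → X → ℝ)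
    {ΔD ρ σbar ε : ℝ} (hD : ∀ x y, |D x - D y| ≤ ΔD) (hPpos : ∀ (n k : ℕ) (x y : X), 0 < P n k x y)
    (hst : ∀ (n k : ℕ), IsStationary
      (fun x => Real.exp (-(linAction S₀ D (((k + 1 : ℕ) : ℝ) / n) x))) (P n k))
    (hProw : ∀ (n k : ℕ) (x : X), ∑ y, P n k x y = 1)
    (hK : ∀ (n k : ℕ), ChiSqContracts (P n k) (gibbsLaw (linAction S₀ D (((k + 1 : ℕ) : ℝ) / n))) ρ)
    (hρ0 : 0 ≤ ρ) (hρ1 : ρ < 1) (hσ0 : 0 ≤ σbar) (hσ : ∀ c, varD S₀ D c ≤ σbar ^ 2)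
    (hε : 0 < ε) :
    ∀ᶠ n : ℕ in atTop, (n : ℝ) * -Real.log
        (essFrac (revPathLaw (fun k : Fin (n + 1) => linAction S₀ D ((k : ℝ) / n))
            (fun k : Fin n => P n k))
          (pathLaw (gibbsLaw (linAction S₀ D (((0 : Fin (n + 1)) : ℝ) / n)))
            (fun k : Fin n => P n k)))
      ≤ (1 + ρ) / (1 - ρ) * σbar ^ 2 + ε :=
  eventually_mul_neg_log_le_of_floor _ hρ1 hε fun n hn0 hθ =>
    exp_le_ess_path_uniform_sharp S₀ D (P n) hn0 hD (hPpos n) (hst n) (hProw n) (hK n) hρ0 hσ0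
      hσ hθ

/-- **`ÊSS_n → 1`.**  Under the hypotheses of `eventually_exp_le_ess_path_uniform` the path ESS of
the `n`-step protocol tends to `1` as `n → ∞`. -/
theorem tendsto_ess_path_uniform (S₀ D : X → ℝ) (P : ℕ → ℕ → X → X → ℝ)
    {ΔD ρ σbar : ℝ} (hD : ∀ x y, |D x - D y| ≤ ΔD) (hPpos : ∀ (n k : ℕ) (x y : X), 0 < P n k x y)
    (hst : ∀ (n k : ℕ), IsStationary
      (fun x => Real.exp (-(linAction S₀ D (((k + 1 : ℕ) : ℝ) / n) x))) (P n k))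
    (hProw : ∀ (n k : ℕ) (x : X), ∑ y, P n k x y = 1)
    (hK : ∀ (n k : ℕ), ChiSqContracts (P n k) (gibbsLaw (linAction S₀ D (((k + 1 : ℕ) : ℝ) / n))) ρ)
    (hρ0 : 0 ≤ ρ) (hρ1 : ρ < 1) (hσ0 : 0 ≤ σbar) (hσ : ∀ c, varD S₀ D c ≤ σbar ^ 2) :
    Tendsto (fun n : ℕ =>
        essFrac (revPathLaw (fun k : Fin (n + 1) => linAction S₀ D ((k : ℝ) / n))
            (fun k : Fin n => P n k))
          (pathLaw (gibbsLaw (linAction S₀ D (((0 : Fin (n + 1)) : ℝ) / n)))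
            (fun k : Fin n => P n k)))
      atTop (𝓝 1) :=
  tendsto_one_of_floor _ hρ1
    (fun n hn0 hθ => exp_le_ess_path_uniform_sharp S₀ D (P n) hn0 hD (hPpos n) (hst n) (hProw n)
      (hK n) hρ0 hσ0 hσ hθ)
    (Eventually.of_forall fun n => ess_path_uniform_le_one S₀ D (P n) (hPpos n) (hst n) (hProw n))

/-! ## §4 Reversible irreducible positive layers (`ρ = sup λ⋆ < 1`) -/

/-- **Asymptotic floor, reversible instance**: layer families in detailed balance with their targets,
irreducible, positive, with `λ⋆(P⁽ⁿ⁾_k) ≤ ρ < 1` for all `n, k`: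
`exp(−(((1+ρ)/(1−ρ))σ̄² + ε)/n) ≤ ÊSS_n` for all large `n`. -/
theorem eventually_exp_le_ess_path_uniform_of_reversible [DecidableEq X] (S₀ D : X → ℝ)
    (P : ℕ → ℕ → X → X → ℝ) {ΔD ρ σbar ε : ℝ} (hD : ∀ x y, |D x - D y| ≤ ΔD)
    (hP : ∀ (n k : ℕ), IsRowStochastic (P n k)) (hPpos : ∀ (n k : ℕ) (x y : X), 0 < P n k x y)
    (hDB : ∀ (n k : ℕ), DetailedBalance (gibbsLaw (linAction S₀ D (((k + 1 : ℕ) : ℝ) / n))) (P n k))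
    (hirr : ∀ (n k : ℕ), IsIrreducible (P n k)) (hlam : ∀ (n k : ℕ), lambdaStar (P n k) ≤ ρ) (hρ1 : ρ < 1)
    (hσ0 : 0 ≤ σbar) (hσ : ∀ c, varD S₀ D c ≤ σbar ^ 2) (hε : 0 < ε) :
    ∀ᶠ n : ℕ in atTop, Real.exp (-(((1 + ρ) / (1 - ρ) * σbar ^ 2 + ε) / n))
      ≤ essFrac (revPathLaw (fun k : Fin (n + 1) => linAction S₀ D ((k : ℝ) / n))
            (fun k : Fin n => P n k))
          (pathLaw (gibbsLaw (linAction S₀ D (((0 : Fin (n + 1)) : ℝ) / n)))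
            (fun k : Fin n => P n k)) :=
  eventually_exp_le_of_floor _ hρ1 hε fun n hn0 hθ =>
    exp_le_ess_path_uniform_sharp_of_reversible S₀ D (P n) hn0 hD (hP n) (hPpos n) (hDB n)
      (hirr n) (hlam n) hσ0 hσ hθ

/-- **Asymptotic `k′` law, reversible instance**: `n·(−log ÊSS_n) ≤ ((1+ρ)/(1−ρ))·σ̄² + ε` for all
large `n`, `ρ` a common bound on the `λ⋆` of the layers. -/
theorem eventually_mul_neg_log_ess_path_uniform_le_of_reversible [DecidableEq X] (S₀ D : X → ℝ)
    (P : ℕ → ℕ → X → X → ℝ) {ΔD ρ σbar ε : ℝ} (hD : ∀ x y, |D x - D y| ≤ ΔD)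
    (hP : ∀ (n k : ℕ), IsRowStochastic (P n k)) (hPpos : ∀ (n k : ℕ) (x y : X), 0 < P n k x y)
    (hDB : ∀ (n k : ℕ), DetailedBalance (gibbsLaw (linAction S₀ D (((k + 1 : ℕ) : ℝ) / n))) (P n k))
    (hirr : ∀ (n k : ℕ), IsIrreducible (P n k)) (hlam : ∀ (n k : ℕ), lambdaStar (P n k) ≤ ρ) (hρ1 : ρ < 1)
    (hσ0 : 0 ≤ σbar) (hσ : ∀ c, varD S₀ D c ≤ σbar ^ 2) (hε : 0 < ε) :
    ∀ᶠ n : ℕ in atTop, (n : ℝ) * -Real.log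
        (essFrac (revPathLaw (fun k : Fin (n + 1) => linAction S₀ D ((k : ℝ) / n))
            (fun k : Fin n => P n k))
          (pathLaw (gibbsLaw (linAction S₀ D (((0 : Fin (n + 1)) : ℝ) / n)))
            (fun k : Fin n => P n k)))
      ≤ (1 + ρ) / (1 - ρ) * σbar ^ 2 + ε :=
  eventually_mul_neg_log_le_of_floor _ hρ1 hε fun n hn0 hθ =>
    exp_le_ess_path_uniform_sharp_of_reversible S₀ D (P n) hn0 hD (hP n) (hPpos n) (hDB n)
      (hirr n) (hlam n) hσ0 hσ hθ

/-- **`ÊSS_n → 1`, reversible instance.** -/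
theorem tendsto_ess_path_uniform_of_reversible [DecidableEq X] (S₀ D : X → ℝ)
    (P : ℕ → ℕ → X → X → ℝ) {ΔD ρ σbar : ℝ} (hD : ∀ x y, |D x - D y| ≤ ΔD)
    (hP : ∀ (n k : ℕ), IsRowStochastic (P n k)) (hPpos : ∀ (n k : ℕ) (x y : X), 0 < P n k x y)
    (hDB : ∀ (n k : ℕ), DetailedBalance (gibbsLaw (linAction S₀ D (((k + 1 : ℕ) : ℝ) / n))) (P n k))
    (hirr : ∀ (n k : ℕ), IsIrreducible (P n k)) (hlam : ∀ (n k : ℕ), lambdaStar (P n k) ≤ ρ) (hρ1 : ρ < 1)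
    (hσ0 : 0 ≤ σbar) (hσ : ∀ c, varD S₀ D c ≤ σbar ^ 2) :
    Tendsto (fun n : ℕ =>
        essFrac (revPathLaw (fun k : Fin (n + 1) => linAction S₀ D ((k : ℝ) / n))
            (fun k : Fin n => P n k))
          (pathLaw (gibbsLaw (linAction S₀ D (((0 : Fin (n + 1)) : ℝ) / n)))
            (fun k : Fin n => P n k)))
      atTop (𝓝 1) :=
  tendsto_one_of_floor _ hρ1
    (fun n hn0 hθ => exp_le_ess_path_uniform_sharp_of_reversible S₀ D (P n) hn0 hD (hP n)
      (hPpos n) (hDB n) (hirr n) (hlam n) hσ0 hσ hθ)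
    (Eventually.of_forall fun n => ess_path_uniform_le_one S₀ D (P n) (hPpos n)
      (fun k => isStationary_exp_of_detailedBalance_gibbsLaw (hDB n k) (hP n k).2)
      (fun k => (hP n k).2))

end Layers

/-! ## §5 Dictionary: the limit constant is the AR(1) `2τ̄` -/

/-- `(1+ρ)/(1−ρ) = 1 + 2ρ/(1−ρ)`: the asymptotic constant exceeds the perfect-relaxation value `1`
(`ρ = 0`: `−log ÊSS_n ≈ σ̄²/n`, the thermodynamic-length law) by the relaxation penalty `2ρ/(1−ρ)`,
increasing in `ρ`. -/
theorem two_tauBar_eq {ρ : ℝ} (hρ1 : ρ < 1) : (1 + ρ) / (1 - ρ) = 1 + 2 * ρ / (1 - ρ) := by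
  have h : 1 - ρ ≠ 0 := by linarith
  field_simp
  ring

-- The monotonicity `ρ ≤ ρ' < 1 ⇒ (1+ρ)/(1−ρ) ≤ (1+ρ')/(1−ρ')` (slower layers never certify a
-- better envelope) is the tree's
-- `Literature.MathematicalPhysics.QuantumFieldTheory.Balaban1983to89.Beta.AliasingTailL1.one_add_div_one_sub_mono`
-- (not restated here).

end Summit.Ventures.LatticeQCDFlow.Scaling
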